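import Literature.NumberTheory.Transcendental.GammaFields
import HarnessLib

/-!
# Strongness descends along algebraic chains

Toolkit for Bays–Kirby 2018, Prop. 11.2 (`Literature.NumberTheory.Transcendental.BaysKirby2018_prop_11_2`; M. Bays, J. Kirby,
*Pseudo-exponential maps, variants, and quasiminimality*, Algebra & Number Theory 12 (2018),
§4). In the proof of Prop. 11.2 the relative algebraic closure of the base inside the
extension is absorbed into the base ("we may assume `A^full ∧ B = A`", proof of Lemma 8.3),
producing a strong subspace `Λ + ℚx̄` where each `x̄ⱼ` satisfies
`td(x̄ⱼ, exp x̄ⱼ / Γ(Λ + ℚx̄_{<j})) ≤ 1` (it, or its exponential, is algebraic). We show that then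
`Λ ◁ F` already, provided `δ(x̄/Λ) ≥ 0` (`GammaField.IsStrong.of_sup_span_chain`): for a finitely
generated `V`, `δ(V/Λ) = δ(V + ℚx̄/Λ) − δ(x̄/Λ + V)`, where
`δ(V + ℚx̄/Λ) = δ(x̄/Λ) + δ(V/Λ + ℚx̄) ≥ 0` and `δ(x̄/Λ + V) ≤ 0` elementwise
(`GammaField.predim_span_chain_nonpos`). These are instances of the addition formula,
Lemma 4.2 (2), and Def. 4.3.

## References

* M. Bays, J. Kirby, *Pseudo-exponential maps, variants, and quasiminimality*, Algebra & Number
  Theory 12 (2018) 493–549: Def. 4.1, Lemma 4.2, Def. 4.3, Lemma 4.8, Lemma 8.3 (proof).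
-/

noncomputable section

open Set

namespace Literature.NumberTheory.Transcendental

namespace GammaField

variable {F : Type*} [Field F] [CharZero F] [Literature.ModelTheory.ExponentialFields.ExponentialRing F]

/-- `δ(y/W) ≤ 0` when `td(y, exp y/Γ(W)) ≤ 1`. [cite: BaysKirby2018ANT, Def. 4.1] -/
theorem predim_span_singleton_nonpos_of_td_le_one {W : Submodule ℚ F} {y : F}
    (h1 : td W (Submodule.span ℚ {y}) ≤ 1) : predim W (Submodule.span ℚ {y}) ≤ 0 := by
  by_cases hy : y ∈ W
  · rw [predim_eq_zero_of_le ((Submodule.span_singleton_le_iff_mem _ _).2 hy)]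
  · rw [predim, ldim_span_singleton_of_not_mem hy]
    have : (td W (Submodule.span ℚ {y})).toNat ≤ 1 := ENat.toNat_le_of_le_coe h1
    omega

/-- **`δ(x̄/W) ≤ 0` along an algebraic chain**: if `td(x̄ⱼ, exp x̄ⱼ/Γ(W + ℚx̄_{<j})) ≤ 1` for
every `j`, then `δ(x̄/W) ≤ 0` (addition formula). [cite: BaysKirby2018ANT, Lemma 4.2 (2)] -/
theorem predim_span_chain_nonpos :
    ∀ {s : ℕ} (W : Submodule ℚ F) (x : Fin s → F),
      (∀ j : Fin s, td (W ⊔ Submodule.span ℚ (range (x ∘ Fin.castLE j.is_lt.le)))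
        (Submodule.span ℚ {x j}) ≤ 1) →
      predim W (Submodule.span ℚ (range x)) ≤ 0
  | 0, W, x, _ => by
    rw [range_eq_empty x, Submodule.span_empty, predim_eq_zero_of_le bot_le]
  | s + 1, W, x, h => by
    -- split off the last element
    have hinit : predim W (Submodule.span ℚ (range (x ∘ Fin.castSucc))) ≤ 0 := by
      refine predim_span_chain_nonpos W (x ∘ Fin.castSucc) fun j => ?_
      have hj := h j.castSucc
      have heq : (x ∘ Fin.castSucc) ∘ Fin.castLE j.is_lt.le = x ∘ Fin.castLE (j.castSucc).is_lt.le := by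
        funext i; rfl
      rw [heq]
      exact hj
    have hlast : predim (W ⊔ Submodule.span ℚ (range (x ∘ Fin.castSucc))) (Submodule.span ℚ {x (Fin.last s)}) ≤ 0 := by
      refine predim_span_singleton_nonpos_of_td_le_one ?_
      have hj := h (Fin.last s)
      have heq : x ∘ Fin.castLE (Fin.last s).is_lt.le = x ∘ Fin.castSucc := by
        funext i; rfl
      rw [heq] at hj
      exact hj
    have hrange : range x = range (x ∘ Fin.castSucc) ∪ {x (Fin.last s)} := by
      ext z
      simp only [mem_range, mem_union, mem_singleton_iff, Function.comp_apply]
      constructor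
      · rintro ⟨i, rfl⟩
        refine Fin.lastCases (Or.inr rfl) (fun j => Or.inl ⟨j, rfl⟩) i
      · rintro (⟨j, rfl⟩ | rfl)
        · exact ⟨_, rfl⟩
        · exact ⟨_, rfl⟩
    have hfg : IsFG W (W ⊔ Submodule.span ℚ (range (x ∘ Fin.castSucc)) ⊔ Submodule.span ℚ {x (Fin.last s)}) :=
      isFG_sup_left.2 ((isFG_span_of_finite W (finite_range _)).sup (isFG_span_of_finite W (finite_singleton _)))
        |> fun h' => by rwa [← sup_assoc] at h'
    have hadd := predim_add (le_sup_left : W ≤ W ⊔ Submodule.span ℚ (range (x ∘ Fin.castSucc)))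
      (le_sup_left : W ⊔ Submodule.span ℚ (range (x ∘ Fin.castSucc)) ≤
        W ⊔ Submodule.span ℚ (range (x ∘ Fin.castSucc)) ⊔ Submodule.span ℚ {x (Fin.last s)}) hfg
    rw [predim_sup_left, predim_sup_left] at hadd
    rw [hrange, Submodule.span_union, ← predim_sup_left, ← sup_assoc, hadd]
    linarith

/-- **Strongness descends along algebraic chains.** If `Λ + ℚx̄ ◁ F`, each `x̄ⱼ` has
`td(x̄ⱼ, exp x̄ⱼ/Γ(Λ + ℚx̄_{<j})) ≤ 1`, and `δ(x̄/Λ) ≥ 0`, then `Λ ◁ F`.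
[cite: BaysKirby2018ANT, Lemma 4.2 (2), Def. 4.3, Lemma 8.3 (proof)] -/
theorem IsStrong.of_sup_span_chain {Λ : Submodule ℚ F} {s : ℕ} {x : Fin s → F}
    (hS : IsStrong (Λ ⊔ Submodule.span ℚ (range x)))
    (hchain : ∀ j : Fin s, td (Λ ⊔ Submodule.span ℚ (range (x ∘ Fin.castLE j.is_lt.le)))
      (Submodule.span ℚ {x j}) ≤ 1)
    (h0 : 0 ≤ predim Λ (Submodule.span ℚ (range x))) : IsStrong Λ := by
  rw [isStrong_iff]
  intro V hV
  have hfgX : IsFG Λ (Submodule.span ℚ (range x)) := isFG_span_of_finite Λ (finite_range x)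
  have hfgVX : IsFG Λ (V ⊔ Submodule.span ℚ (range x)) := hV.sup hfgX
  -- `δ(V + X/Λ)` two ways
  have e1 : predim Λ (V ⊔ Submodule.span ℚ (range x)) =
      predim Λ V + predim (Λ ⊔ V) (Submodule.span ℚ (range x)) := by
    have := predim_add (le_sup_left : Λ ≤ Λ ⊔ V)
      (le_sup_left : Λ ⊔ V ≤ (Λ ⊔ V) ⊔ Submodule.span ℚ (range x))
      (by rw [sup_assoc]; exact isFG_sup_left.2 hfgVX)
    rw [predim_sup_left, predim_sup_left, sup_assoc, predim_sup_left] at this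
    exact this
  have e2 : predim Λ (V ⊔ Submodule.span ℚ (range x)) =
      predim Λ (Submodule.span ℚ (range x)) + predim (Λ ⊔ Submodule.span ℚ (range x)) V := by
    have := predim_add (le_sup_left : Λ ≤ Λ ⊔ Submodule.span ℚ (range x))
      (le_sup_left : Λ ⊔ Submodule.span ℚ (range x) ≤ (Λ ⊔ Submodule.span ℚ (range x)) ⊔ V)
      (by rw [sup_assoc, sup_comm (Submodule.span ℚ (range x)) V]; exact isFG_sup_left.2 hfgVX)
    rw [predim_sup_left, predim_sup_left, sup_assoc, predim_sup_left, sup_comm] at this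
    exact this
  -- `δ(x̄/Λ + V) ≤ 0` and `δ(V/Λ + ℚx̄) ≥ 0`
  have hXV : predim (Λ ⊔ V) (Submodule.span ℚ (range x)) ≤ 0 := by
    refine predim_span_chain_nonpos _ x fun j => ?_
    refine (td_anti _ ?_).trans (hchain j)
    exact sup_le_sup_right le_sup_left _
  have hSV : 0 ≤ predim (Λ ⊔ Submodule.span ℚ (range x)) V :=
    isStrong_iff.1 hS V (hV.of_le_left le_sup_left)
  linarith

end GammaField

end Literature.NumberTheory.Transcendental
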